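import Literature.AlgebraicGeometry.Motives.GaloisDescentDatumOfTwists
import Literature.AlgebraicGeometry.Motives.GaloisDescentFunctor
import Literature.AlgebraicGeometry.Motives.SemilinearActionOfGenerators
import HarnessLib

/-!
# The Galois descent datum on the model over the compositum: the ACTION of `Gal(L/k)` and the packaged `Datum`
# ([Deligne 1971] Prop. 5.10 via Cor. 5.5 + Lemme 5.10.1 — piece «D3a» of the cell's I-6 crew)

Sequel of `GaloisDescentDatumOfTwists` (A-p08, D1/D2: the rigidity predicate `Good` on `γ`-semilinear automorphisms of the model
`N i₀ = M i₀ ⊗_{F i₀} L`, unique / closed under the group operations / inhabited on the subgroups `Gal(L/F i)` / natural in the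
level) and of `SemilinearActionOfGenerators` (B-typ01, P3-gen: rigid automorphisms given on generating subgroups assemble to an
action).  Here the two are put together:

* `exists_action` — if the subgroups `H i ≤ Gal(L/k)` (each fixing `F i` pointwise) generate, `⨆ H i = ⊤` (in the cell: `k = ⋂ F i`,
  A-p03), there are actions `ρ j : ActionOver ((N i₀ j).hom ≫ bcSpec k L) (L ≃ₐ[k] L)` ALL of whose automorphisms are `Good`
  (unique: `action_unique`); they are semilinear and natural in `j` (`natural_of_good`);
* `exists_datum` — for PROJECTIVE `N i₀ j` this is a `GaloisDescentFunctor.Datum k (N i₀)` (A-p16, P4: the input of effective Galois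
  descent of the diagram), the covering hypothesis being automatic (`cov_of_isProjectiveOver`) and reducedness of `N i₀ j` descending
  from that of its complexification (`isReduced_of_baseChange`).

Everything is proved; no named fact, no definition, no instance.  Cell hodgecm-mathlib, row I-6 (`descentToIntersection_printed`),
crew of 2026-08-28 lead A-p08 (CREW MAP v3 06:54:37Z: D3a = B-typ01; D3b = A-p16 consumes `exists_datum`).  HC_CM is proved only
modulo the 7 printed citations until rung 0 closes; this file proves no cell binder by itself.

## References
* [Deligne1971TravauxShimura] P. Deligne, *Travaux de Shimura*, Sém. Bourbaki 389, LNM 244 (1971): Cor. 5.5 (p. 156), Prop. 5.10 and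
  Lemme 5.10.1 (pp. 157–158).
* [GortzWedhorn2020] U. Görtz, T. Wedhorn, *Algebraic Geometry I* (2nd ed. 2020), §(14.20)–(14.21), Thm. 14.83, Cor. 14.85.
-/

noncomputable section

open CategoryTheory CategoryTheory.Limits AlgebraicGeometry Cardinal

namespace Literature.AlgebraicGeometry.Motives

namespace GaloisDescentTwist

open AbelianVariety (bcSpec bcFunctor specAut)
open Literature.AlgebraicGeometry.RelativeSpec (ActionOver)
open GaloisDescent

set_option backward.isDefEq.respectTransparency false

variable {J : Type} [Category J] (Z : J ⥤ SchemeOver ℂ)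
  (Tw : ∀ j : J, (ℂ ≃+* ℂ) → ((Z.obj j).left ⟶ (Z.obj j).left) → Prop)
  {k : Type} [Field k] (L : Type) [Field L] [Algebra k L] [Algebra L ℂ]
  {ι : Type} {F : ι → Type} [∀ i, Field (F i)] [∀ i, Algebra (F i) L] [∀ i, Algebra (F i) ℂ]
  [∀ i, IsScalarTower (F i) L ℂ]
  (M : ∀ i, J ⥤ SchemeOver (F i)) (e : ∀ i, (M i ⋙ bcFunctor (F i) ℂ) ≅ Z) (i₀ : ι)
  (hext : ∀ γ : L ≃ₐ[k] L, ∃ σ : ℂ ≃+* ℂ, ∀ x : L, σ (algebraMap L ℂ x) = algebraMap L ℂ (γ x))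
  (huniq : ∀ (j : J) (σ : ℂ ≃+* ℂ) (u v : (Z.obj j).left ⟶ (Z.obj j).left), Tw j σ u → Tw j σ v → u = v)
  (hgal : ∀ (i : ι) (j : J) (σ : ℂ ≃ₐ[F i] ℂ),
    Tw j (σ : ℂ ≃+* ℂ) (((e i).inv.app j).left ≫ gal ℂ ((M i).obj j) σ ≫ ((e i).hom.app j).left))
  (hmul : ∀ (j : J) (σ ρ : ℂ ≃+* ℂ) (u v : (Z.obj j).left ⟶ (Z.obj j).left), Tw j σ u → Tw j ρ v → Tw j (σ * ρ) (v ≫ u))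
  (hnat : ∀ ⦃j j' : J⦄ (f : j ⟶ j') (σ : ℂ ≃+* ℂ) (u : (Z.obj j).left ⟶ (Z.obj j).left)
    (u' : (Z.obj j').left ⟶ (Z.obj j').left), Tw j σ u → Tw j' σ u' → u ≫ (Z.map f).left = (Z.map f).left ≫ u')
  (H : ι → Subgroup (L ≃ₐ[k] L))
  (hHle : ∀ i, ∀ γ ∈ H i, ∀ x : F i, γ (algebraMap (F i) L x) = algebraMap (F i) L x)

/-! ## 1. The action of `Gal(L/k)` on `N i₀` by `Good` automorphisms -/

include hext huniq hgal hmul hHle in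
/-- **The Galois action on the model over the compositum.**  If the subgroups `H i` (each fixing `F i` pointwise) generate `Gal(L/k)`,
every object `N i₀ j = M i₀ j ⊗ L` carries an action of `Gal(L/k)` by automorphisms over `Spec k` ALL of which are `Good`
(= P3-gen `exists_actionOver_galois_of_generators_of_semilinear` fed with `good_unique`/`good_one`/`good_mul`/`good_inv`/`good_of_mem`).
Hypotheses as in Deligne's 5.5/5.10: `L` countable, the complex fibres reduced, the models separated over `L`.
[cite: Deligne1971TravauxShimura, Prop. 5.10, proof (pp. 157–158) with Cor. 5.5 and Lemme 5.10.1] -/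
theorem exists_action [FiniteDimensional k L] (hL : #L ≤ ℵ₀) (hred : ∀ i j, IsReduced (bc ℂ ((N L M i).obj j)))
    (hsep : ∀ i j, IsSeparated ((N L M i).obj j).hom) (hH : ⨆ i, H i = ⊤) :
    ∃ ρ : ∀ j, ActionOver (((N L M i₀).obj j).hom ≫ bcSpec k L) (L ≃ₐ[k] L),
      ∀ j γ, Good Z Tw L M e i₀ j γ ((ρ j).aut γ) :=
  exists_actionOver_galois_of_generators_of_semilinear H (N L M i₀) (Good Z Tw L M e i₀) hH
    (fun _ _ _ h => h.semilinear)
    (fun j γ φ ψ hφ hψ => good_unique Z Tw L M e i₀ hext huniq j γ φ ψ hφ hψ)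
    (fun j => good_one Z Tw L M e i₀ hgal j)
    (fun j γ δ φ ψ hφ hψ => good_mul Z Tw L M e i₀ hext hmul j γ δ φ ψ hφ hψ)
    (fun j γ φ hφ => good_inv Z Tw L M e i₀ hext huniq hgal hmul j γ φ hφ)
    (fun i j γ hγ => good_of_mem Z Tw L M e i₀ huniq hgal hL i j (hred i₀ j) (hred i j) (hsep i₀ j) (hsep i j) γ
      (hHle i γ hγ))

include hext huniq in
/-- Uniqueness of the action by `Good` automorphisms (componentwise, `good_unique`).
[cite: Deligne1971TravauxShimura, Cor. 5.5 (p. 156) and Prop. 5.10 (uniqueness)] -/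
theorem action_unique (ρ ρ' : ∀ j, ActionOver (((N L M i₀).obj j).hom ≫ bcSpec k L) (L ≃ₐ[k] L))
    (hρ : ∀ j γ, Good Z Tw L M e i₀ j γ ((ρ j).aut γ)) (hρ' : ∀ j γ, Good Z Tw L M e i₀ j γ ((ρ' j).aut γ)) : ρ = ρ' :=
  ActionOver.family_unique_of_generators (fun j => ((N L M i₀).obj j).left) (fun j => ((N L M i₀).obj j).hom ≫ bcSpec k L)
    (Good Z Tw L M e i₀) (fun j _ _ _ hφ hψ => good_unique Z Tw L M e i₀ hext huniq j _ _ _ hφ hψ) ρ ρ' hρ hρ'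

include hext hnat in
/-- An action by `Good` automorphisms is natural in the level (`good_natural`). [cite: Deligne1971TravauxShimura, Prop. 5.10, proof (pp. 157–158)] -/
theorem natural_of_good (ρ : ∀ j, ActionOver (((N L M i₀).obj j).hom ≫ bcSpec k L) (L ≃ₐ[k] L))
    (hρ : ∀ j γ, Good Z Tw L M e i₀ j γ ((ρ j).aut γ)) ⦃j j' : J⦄ (f : j ⟶ j') (γ : L ≃ₐ[k] L) :
    ((ρ j).aut γ).hom ≫ ((N L M i₀).map f).left = ((N L M i₀).map f).left ≫ ((ρ j').aut γ).hom :=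
  good_natural Z Tw L M e i₀ hext hnat f γ _ _ (hρ j γ) (hρ j' γ)

/-- An action by `Good` automorphisms is semilinear (`Good.semilinear`). [cite: Deligne1971TravauxShimura, Lemme 5.10.1 (p. 158)] -/
theorem semilinear_of_good (ρ : ∀ j, ActionOver (((N L M i₀).obj j).hom ≫ bcSpec k L) (L ≃ₐ[k] L))
    (hρ : ∀ j γ, Good Z Tw L M e i₀ j γ ((ρ j).aut γ)) (j : J) (γ : L ≃ₐ[k] L) :
    ((ρ j).aut γ).hom ≫ ((N L M i₀).obj j).hom = ((N L M i₀).obj j).hom ≫ specAut L γ⁻¹ :=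
  (hρ j γ).semilinear

/-! ## 2. The packaged descent datum for projective models -/

include hext huniq hgal hmul hnat hHle in
/-- **The Galois descent datum on `N i₀`** (input of A-p16's effective descent `GaloisDescentFunctor.Datum`): for PROJECTIVE,
separated, locally-of-finite-type models with reduced complex fibres, the `Good` action of `exists_action` together with its
semilinearity and naturality, the automatic covering hypothesis (`cov_of_isProjectiveOver`) and reducedness of `N i₀ j` descended
from `N i₀ j ⊗ ℂ` (`isReduced_of_baseChange`). [cite: Deligne1971TravauxShimura, Prop. 5.10, proof (pp. 157–158) with Lemme 5.10.1]
[cite: GortzWedhorn2020, Thm. 14.83 and Cor. 14.85] -/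
theorem exists_datum [FiniteDimensional k L] (hL : #L ≤ ℵ₀) (hred : ∀ i j, IsReduced (bc ℂ ((N L M i).obj j)))
    (hsep : ∀ i j, IsSeparated ((N L M i).obj j).hom) (hH : ⨆ i, H i = ⊤)
    (hproj : ∀ j, IsProjectiveOver ((N L M i₀).obj j)) (hlft : ∀ j, LocallyOfFiniteType ((N L M i₀).obj j).hom) :
    ∃ D : GaloisDescentFunctor.Datum k (N L M i₀), ∀ j γ, Good Z Tw L M e i₀ j γ ((D.ρ j).aut γ) := by
  obtain ⟨ρ, hρ⟩ := exists_action Z Tw L M e i₀ hext huniq hgal hmul H hHle hL hred hsep hH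
  refine ⟨{ ρ := ρ
            semilinear := fun j σ => (hρ j σ).semilinear
            natural := fun j j' f σ => natural_of_good Z Tw L M e i₀ hext hnat ρ hρ f σ
            cov := fun j => by
              haveI := hsep i₀ j
              exact cov_of_isProjectiveOver L ((N L M i₀).obj j) (hproj j) (ρ j)
            locallyOfFiniteType := hlft
            separated := fun j => hsep i₀ j
            reduced := fun j => isReduced_of_baseChange ℂ ((N L M i₀).obj j) (hred i₀ j) }, hρ⟩

end GaloisDescentTwist

end Literature.AlgebraicGeometry.Motives

end
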